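import Summits.HodgeConjecture.CorCM.Census.OddIndexGeneration

/-!
# Two-adic splitting: for a `2`-group the `2`-ADIC closing faces come for free — fibre-independent odd generation ⟹ `μ = φ₂`

COR-CM (cell `pub-hodgecm2`), count-neutral kernel combinatorics by the binder seat b09 (gen 38; lane TWO-ADIC SPLITTING +
NONDEGENERATE REDUCTION, part B), on top of seat b09ʼs `Census/CoinvariantFibre/Floor/TwoGroups` (`fibre`, `fibreTwo`, `rad2`,
`hodge2_le_of_isPGroup`) and seat b23ʼs `Census/OddIndexGeneration.lean` (`exists_odd_smul_mem_of_hodge2_le`,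
`generate_of_odd_smul_of_two_pow_smul`) used BY NAME.  Theorems only: no definition, no `decide`, no certificate, no named fact, no `sorry`.
HONEST FRAMING: `HC_CM` is NOT proved, here or anywhere in the tree; nothing here is a period or a headline.

THE SETTING of `Census/CoinvariantFibre.lean`: `G` finite, `c` a central involution `≠ 1`, faces `gfaceSet`, pairs `pairSet`, the Hodge
lattice `hodgeSpan`, the reductions `red`, `hodge2`, `rad2` and the coinvariant fibre `hodge2 / rad2` of dimension `φ₂(G,c) = fibreTwo`;
the census number `μ(G,c)` = least number of faces whose base changes generate `hodgeSpan` modulo pairs, `μ ≥ φ₂` always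
(`Coinvariant.fibreTwo_le_card_of_faces`).  The FIBRE IMAGE of an integer vector `f` is the class of `red f` in `𝔽₂[types] / rad2`; a family is
FIBRE-INDEPENDENT if its fibre images are linearly independent over `𝔽₂`.

**THEOREM (`exists_generate_extension_of_isPGroup`, §2).**  Let `G` be a `2`-group and `S₀ ⊆ gfaceSet` a finite FIBRE-INDEPENDENT family of
faces which generates AFTER INVERTING `2`: `2^k · hodgeSpan ⊆ ℤ⟨pairs⟩ + ℤ⟨base changes of S₀⟩` for some `k`.  Then `S₀` extends to a family
`S ⊆ gfaceSet` of EXACTLY `φ₂(G,c)` faces with `hodgeSpan ≤ ℤ⟨pairs⟩ + ℤ⟨base changes of S⟩`; hence `μ(G,c) = φ₂(G,c)`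
(`isLeast_card_gfaces_generate_of_isPGroup`).  The added faces are ANY faces completing the fibre images of `S₀` to a basis of the fibre —
the `2`-adic part of the closing of every `2`-group law is free, and the per-family work shrinks to ODD generation (part A,
`Census/NondegenerateReduction.lean`: complete reduction onto a Kubota-nondegenerate base type).

PROOF.  §1 (`exists_faces_extension`): extend the fibre images of `S₀` to a basis of the fibre inside the images of faces
(`exists_linearIndepOn_extension`; the fibre is spanned by face images, `Coinvariant.fibre_eq_map_face2`), i.e. a family `S ⊇ S₀` of `φ₂` faces
with `hodge2 ≤ rad2 + 𝔽₂⟨red S⟩`.  §2: by Nakayama for the `2`-group `G` (`Coinvariant.hodge2_le_of_isPGroup`) `red S` generates `hodge2` modulo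
`pair2` over `𝔽₂[G]`; seat b23ʼs lifting gives an odd `m` with `m · hodgeSpan ⊆ ℤ⟨pairs⟩ + ℤ[G]·S`, while `2^k · hodgeSpan ⊆ ℤ⟨pairs⟩ + ℤ[G]·S₀
⊆ ℤ⟨pairs⟩ + ℤ[G]·S`; Bézout (`OddIndex.generate_of_odd_smul_of_two_pow_smul`).

§3 CRITERIA for fibre-independence: the BLOCK PARITIES factor through the fibre (`rad2 ≤ ker par2`), so parity-independent families are
fibre-independent (`fibreIndep_of_parityIndep`); and a PIVOT CRITERION for parity-independence (`linearIndepOn_of_pivot`: each member has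
parity `1` at its pivot block and parity `0` at the pivot of every other member of higher-or-equal rank — the shape of every covering family,
rank = potential, pivot = own block; part C, `Census/BaseBlockCovering.lean`).

## References
* [Pohlmann1968] H. Pohlmann, Algebraic cycles on abelian varieties of complex multiplication type, Ann. of Math. 88 (1968), Thm 1.
* [Milne1999] J. S. Milne, Lefschetz motives and the Tate conjecture, Compositio Math. 117 (1999), Prop. 2.1, p. 54.
-/

namespace Summit.HodgeConjecture.CorCM.Census.Splitting

open Finset
open Summit.HodgeConjecture.CorCM.Prior.AllgGroup.RfwfAllgGroup
open Summit.HodgeConjecture.CorCM.Census.BlockParity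
open Summit.HodgeConjecture.CorCM.Census.Coinvariant
open Summit.HodgeConjecture.CorCM.Census.OddIndex

noncomputable section

variable {G : Type*} [Group G] [Fintype G] [DecidableEq G] (c : G)

/-! ## §1 Completing a fibre-independent face family to a fibre basis by faces -/

/-- The span of the fibre images of all faces is the fibre. [folklore] -/
theorem span_image_gfaceSet_eq_fibre (hc2 : c * c = 1) :
    Submodule.span (ZMod 2) ((fun f : CMF G c →₀ ℤ => (rad2 c hc2).mkQ (red c f)) '' gfaceSet G c hc2) = fibre c hc2 := by
  rw [fibre_eq_map_face2, face2, ← Submodule.span_image, faces2, Set.image_image]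

/-- **Fibre-basis completion by faces.**  A fibre-independent family `S₀` of faces extends to a family `S` of EXACTLY `φ₂(G,c)` faces whose
reductions span `hodge2` modulo `rad2`. [folklore] -/
theorem exists_faces_extension (hc2 : c * c = 1) (S₀ : Finset (CMF G c →₀ ℤ)) (hS₀ : (↑S₀ : Set (CMF G c →₀ ℤ)) ⊆ gfaceSet G c hc2)
    (hli : LinearIndepOn (ZMod 2) (fun f : CMF G c →₀ ℤ => (rad2 c hc2).mkQ (red c f)) ↑S₀) :
    ∃ S : Finset (CMF G c →₀ ℤ), S₀ ⊆ S ∧ (↑S : Set (CMF G c →₀ ℤ)) ⊆ gfaceSet G c hc2 ∧ S.card = fibreTwo c hc2 ∧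
      hodge2 c hc2 ≤ rad2 c hc2 ⊔ Submodule.span (ZMod 2) ((S.image (red c) : Finset (CMF G c →₀ ZMod 2)) : Set (CMF G c →₀ ZMod 2)) := by
  classical
  set v : (CMF G c →₀ ℤ) → (CMF G c →₀ ZMod 2) ⧸ rad2 c hc2 := fun f => (rad2 c hc2).mkQ (red c f) with hv
  obtain ⟨b, hbt, hsb, hspan, hbli⟩ := exists_linearIndepOn_extension hli hS₀
  have hbfin : b.Finite := Set.finite_coe_iff.mp hbli.linearIndependent.finite
  letI : Fintype ↥b := hbfin.fintype
  refine ⟨b.toFinset, fun x hx => Set.mem_toFinset.mpr (hsb hx), fun x hx => hbt (Set.mem_toFinset.mp hx), ?_, ?_⟩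
  · -- `|b| = φ₂`: `b` maps injectively onto a basis of the fibre
    have hspan_eq : Submodule.span (ZMod 2) (Set.range fun x : b => v x) = fibre c hc2 := by
      rw [← Set.image_eq_range, ← span_image_gfaceSet_eq_fibre c hc2]
      exact le_antisymm (Submodule.span_mono (Set.image_mono hbt)) (Submodule.span_le.mpr hspan)
    have h := finrank_span_eq_card (R := ZMod 2) hbli.linearIndependent
    rw [hspan_eq] at h
    rw [Set.toFinset_card]
    exact h.symm
  · -- `hodge2 ≤ rad2 + 𝔽₂⟨red b⟩`
    have hF : faces2 c hc2 ⊆ ↑(rad2 c hc2 ⊔ Submodule.span (ZMod 2) ((b.toFinset.image (red c) : Finset _) : Set (CMF G c →₀ ZMod 2))) := by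
      rintro _ ⟨f, hf, rfl⟩
      have hvf : v f ∈ Submodule.span (ZMod 2) (v '' b) := hspan ⟨f, hf, rfl⟩
      have e : v '' b = (rad2 c hc2).mkQ '' ((b.toFinset.image (red c) : Finset _) : Set (CMF G c →₀ ZMod 2)) := by
        rw [Finset.coe_image, Set.coe_toFinset, Set.image_image]
      rw [e, Submodule.span_image] at hvf
      obtain ⟨z, hz, hzf⟩ := Submodule.mem_map.mp hvf
      have hker : red c f - z ∈ rad2 c hc2 := by
        rw [← Submodule.ker_mkQ (rad2 c hc2), LinearMap.mem_ker, map_sub, sub_eq_zero]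
        exact hzf.symm
      have esum : red c f = (red c f - z) + z := by abel
      rw [SetLike.mem_coe, esum]
      exact Submodule.add_mem _ (Submodule.mem_sup_left hker) (Submodule.mem_sup_right hz)
    rw [hodge2]
    refine sup_le ?_ ((pair2_le_rad2 c hc2).trans le_sup_left)
    rw [face2]
    exact Submodule.span_le.mpr hF

/-! ## §2 THE SPLITTING THEOREM for `2`-groups -/

/-- **TWO-ADIC SPLITTING.**  For a `2`-group `G` (central involution `c ≠ 1`): a fibre-independent family of faces generating `hodgeSpan` modulo
pairs after inverting `2` extends to EXACTLY `φ₂(G,c)` faces generating `hodgeSpan` modulo pairs. [folklore] -/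
theorem exists_generate_extension_of_isPGroup (hG : IsPGroup 2 G) (hc2 : c * c = 1) (hc1 : c ≠ 1) (hcen : ∀ x : G, x * c = c * x)
    (S₀ : Finset (CMF G c →₀ ℤ)) (hS₀ : (↑S₀ : Set (CMF G c →₀ ℤ)) ⊆ gfaceSet G c hc2)
    (hli : LinearIndepOn (ZMod 2) (fun f : CMF G c →₀ ℤ => (rad2 c hc2).mkQ (red c f)) ↑S₀) (k : ℕ)
    (htwo : ∀ y ∈ hodgeSpan c hc2, ((2 : ℤ) ^ k) • y ∈ Submodule.span ℤ (pairSet c) ⊔ Submodule.span ℤ (translates c S₀)) :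
    ∃ S : Finset (CMF G c →₀ ℤ), S₀ ⊆ S ∧ (↑S : Set (CMF G c →₀ ℤ)) ⊆ gfaceSet G c hc2 ∧ S.card = fibreTwo c hc2 ∧
      hodgeSpan c hc2 ≤ Submodule.span ℤ (pairSet c) ⊔ Submodule.span ℤ (translates c S) := by
  obtain ⟨S, hS₀S, hS, hcard, hle⟩ := exists_faces_extension c hc2 S₀ hS₀ hli
  have hSH : (↑S : Set (CMF G c →₀ ℤ)) ⊆ hodgeSpan c hc2 := hS.trans (gfaceSet_subset_hodgeSpan c hc2)
  have hS2 : ((S.image (red c) : Finset (CMF G c →₀ ZMod 2)) : Set (CMF G c →₀ ZMod 2)) ⊆ hodge2 c hc2 := by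
    intro x hx
    obtain ⟨s, hs, rfl⟩ := mem_image.mp (mem_coe.mp hx)
    exact red_mem_hodge2 c hc2 (hSH hs)
  have h2 := hodge2_le_of_isPGroup c hG hc2 hcen (S.image (red c)) hS2 hle
  obtain ⟨m, hm, hodd⟩ := exists_odd_smul_mem_of_hodge2_le c hc2 hc1 hcen S hSH h2
  have hsub : translates c S₀ ⊆ translates c S := by
    rintro _ ⟨Q, s, hs, rfl⟩
    exact ⟨Q, s, hS₀S hs, rfl⟩
  have hmono : Submodule.span ℤ (pairSet c) ⊔ Submodule.span ℤ (translates c S₀) ≤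
      Submodule.span ℤ (pairSet c) ⊔ Submodule.span ℤ (translates c S) :=
    sup_le_sup_left (Submodule.span_mono hsub) _
  exact ⟨S, hS₀S, hS, hcard, generate_of_odd_smul_of_two_pow_smul c hc2 S hm k hodd fun y hy => hmono (htwo y hy)⟩

/-- **`μ(G,c) = φ₂(G,c)` for a `2`-group from ODD generation by a fibre-independent face family.** [folklore] -/
theorem isLeast_card_gfaces_generate_of_isPGroup (hG : IsPGroup 2 G) (hc2 : c * c = 1) (hc1 : c ≠ 1) (hcen : ∀ x : G, x * c = c * x)
    (S₀ : Finset (CMF G c →₀ ℤ)) (hS₀ : (↑S₀ : Set (CMF G c →₀ ℤ)) ⊆ gfaceSet G c hc2)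
    (hli : LinearIndepOn (ZMod 2) (fun f : CMF G c →₀ ℤ => (rad2 c hc2).mkQ (red c f)) ↑S₀) (k : ℕ)
    (htwo : ∀ y ∈ hodgeSpan c hc2, ((2 : ℤ) ^ k) • y ∈ Submodule.span ℤ (pairSet c) ⊔ Submodule.span ℤ (translates c S₀)) :
    IsLeast {n : ℕ | ∃ S : Finset (CMF G c →₀ ℤ), (↑S ⊆ gfaceSet G c hc2) ∧ S.card = n ∧
      hodgeSpan c hc2 ≤ Submodule.span ℤ (pairSet c) ⊔ Submodule.span ℤ (translates c S)} (fibreTwo c hc2) := by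
  refine ⟨?_, ?_⟩
  · obtain ⟨S, -, hS, hcard, hgen⟩ := exists_generate_extension_of_isPGroup c hG hc2 hc1 hcen S₀ hS₀ hli k htwo
    exact ⟨S, hS, hcard, hgen⟩
  · rintro n ⟨S, hS, rfl, hgen⟩
    exact fibreTwo_le_card_of_faces c hc2 hcen S hS fun y hy => hgen (gfaceSet_subset_hodgeSpan c hc2 hy)

/-- **The size of the odd family bounds nothing but itself**: a fibre-independent face family has at most `φ₂(G,c)` members (any `G`).
[folklore] -/
theorem card_le_fibreTwo_of_fibreIndep (hc2 : c * c = 1) (S₀ : Finset (CMF G c →₀ ℤ))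
    (hS₀ : (↑S₀ : Set (CMF G c →₀ ℤ)) ⊆ gfaceSet G c hc2)
    (hli : LinearIndepOn (ZMod 2) (fun f : CMF G c →₀ ℤ => (rad2 c hc2).mkQ (red c f)) ↑S₀) : S₀.card ≤ fibreTwo c hc2 := by
  obtain ⟨S, hS₀S, -, hcard, -⟩ := exists_faces_extension c hc2 S₀ hS₀ hli
  rw [← hcard]
  exact Finset.card_le_card hS₀S

/-! ## §3 Criteria for fibre-independence: block parities, and the pivot criterion -/

/-- **Parity-independent ⟹ fibre-independent**: the block parities factor through the coinvariant fibre (`rad2 ≤ ker par2`). [folklore] -/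
theorem fibreIndep_of_parityIndep (hc2 : c * c = 1) (s : Set (CMF G c →₀ ℤ))
    (h : LinearIndepOn (ZMod 2) (fun f : CMF G c →₀ ℤ => par c f) s) :
    LinearIndepOn (ZMod 2) (fun f : CMF G c →₀ ℤ => (rad2 c hc2).mkQ (red c f)) s := by
  set pbar : ((CMF G c →₀ ZMod 2) ⧸ rad2 c hc2) →ₗ[ZMod 2] (Block c → ZMod 2) :=
    (rad2 c hc2).liftQ (par2 c) (rad2_le_ker_par2 c hc2) with hpbar
  have e : (fun f : CMF G c →₀ ℤ => par c f) = pbar ∘ (fun f : CMF G c →₀ ℤ => (rad2 c hc2).mkQ (red c f)) := by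
    funext f
    simp only [Function.comp_apply, hpbar, Submodule.mkQ_apply, Submodule.liftQ_apply, par2_red]
  rw [e] at h
  exact LinearIndepOn.of_comp pbar h

/-- **Pivot criterion** (unitriangularity): a family of vectors `v i : X → K` with a pivot map `p` and a rank `ℓ` such that `v i (p i) ≠ 0`
and `v i (p j) = 0` whenever `i ≠ j` in the family with `ℓ i ≤ ℓ j`, is linearly independent.  (Every covering family: `v` = block parity,
pivot = own block, rank = potential.) [folklore] -/
theorem linearIndepOn_of_pivot {K : Type*} [Field K] {ι X : Type*} (v : ι → X → K) (s : Set ι) (p : ι → X) (ℓ : ι → ℕ)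
    (hdiag : ∀ i ∈ s, v i (p i) ≠ 0) (hoff : ∀ i ∈ s, ∀ j ∈ s, i ≠ j → ℓ i ≤ ℓ j → v i (p j) = 0) :
    LinearIndepOn K v s := by
  classical
  rw [LinearIndepOn, linearIndependent_iff']
  intro t g hsum i₁ hi₁t
  by_contra hgi₁
  -- a member with nonzero coefficient of maximal rank
  obtain ⟨i₀, hi₀, hmax⟩ := Finset.exists_max_image (t.filter fun i => g i ≠ 0) (fun i => ℓ i.1) ⟨i₁, mem_filter.mpr ⟨hi₁t, hgi₁⟩⟩
  obtain ⟨hi₀t, hgi₀⟩ := mem_filter.mp hi₀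
  have heval := congrFun hsum (p i₀.1)
  rw [Finset.sum_apply, Pi.zero_apply, Finset.sum_eq_single_of_mem i₀ hi₀t] at heval
  · rw [Pi.smul_apply, smul_eq_mul] at heval
    exact (mul_ne_zero hgi₀ (hdiag i₀.1 i₀.2)) heval
  · intro j hjt hji
    rw [Pi.smul_apply, smul_eq_mul]
    by_cases hgj : g j = 0
    · rw [hgj, zero_mul]
    · have hlj : ℓ j.1 ≤ ℓ i₀.1 := hmax j (mem_filter.mpr ⟨hjt, hgj⟩)
      rw [hoff j.1 j.2 i₀.1 i₀.2 (fun e => hji (Subtype.ext e)) hlj, mul_zero]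

end

end Summit.HodgeConjecture.CorCM.Census.Splitting
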